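import Mathlib
import Summits.RiemannHypothesis.RiemannHypothesis.Theorems.WeilFarCoercivityFloor
import Summits.RiemannHypothesis.RiemannHypothesis.Theorems.WeilFarFloorLowerBounds
import Summits.RiemannHypothesis.RiemannHypothesis.Theorems.WeilFormatCCellShiftBoundA083
import Summits.RiemannHypothesis.RiemannHypothesis.Theorems.WeilFormatCCellShiftBoundA09
import Summits.RiemannHypothesis.RiemannHypothesis.Theorems.WeilFormatCCellShiftBoundA09729
import Summits.RiemannHypothesis.RiemannHypothesis.Theorems.WeilFormatCCellShiftBoundA1v2
import Summits.RiemannHypothesis.RiemannHypothesis.Theorems.WeilFormatCCellShiftBoundA10397v2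
import Summits.RiemannHypothesis.RiemannHypothesis.Theorems.WeilFormatCCellShiftBoundA1098
import HarnessLib

/-!
# The far-coercivity floor, bracketed in the kernel: `L ≤ λ_max(a) ≤ A`

Helper file (`--supports stmt-RiemannHypothesis-0098`, lead-track anchor: Weil-positivity window ladder, format-C far bound),
RH-free, pure proofs.  Seat rh-explicit-weil-1 gen8 (memo `run/shared/lean/pub/rh-explicit/rh-explicit-weil-1/FORMAT-K3.md` §9).

`WeilFarCoercivityFloor` defines the floor `farCoercivityFloor a = sup_f Q_a(f)/∫f²` of the prime-shift form (the object of
STRUCTURE.md conjecture C-XIII) and proves (appendix, p376521) that it is the LEAST uniform shift bound (`shiftBound_range_floor`),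
monotone, and of exponential order.  Here the numeric window brackets:
* the two-step test functions of `WeilFarFloorLowerBounds` bound the floor from BELOW, and the landed route-K3 rows
  (`jointShiftBound_…_cells…`, certificates `cellA083p4 … cellA1098p4`) bound it from ABOVE — kernel brackets:
  `λ_max(83/100) ≤ 1574/1000`, `λ_max(9/10) ≤ 1730/1000`, `λ_max(9729/10000) ≤ 1825/1000`,
  **`1838/1000 ≤ λ_max(1) ≤ 2027/1000`**, `λ_max(10397/10000) ≤ 2148/1000`, `λ_max(1098/1000) ≤ 2358/1000`,
  `2649/1000 ≤ λ_max(1198/1000)`, `3080/1000 ≤ λ_max(1289/1000)`, and uniformly `((7/5)e^a − 12a + 11)/(2a) ≤ λ_max(a)` (a ≥ 3,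
  `WeilFarFloorGrowth`) and `λ_max(a) ≤ 38(e^a + 1)` (all `a > 0`, `WeilFarFloorOrder`) (Galerkin floats: 1.471, 1.660, 1.779, 1.946, 2.058, 2.285,
  2.695, 3.144; the lower sides at 83/100 … 1098/1000 and 1282 … 3/2 live in `WeilFarFloorLowerBoundsB/C`).
Standard axioms only.
-/

set_option linter.dupNamespace false
set_option autoImplicit false

noncomputable section

open MeasureTheory Set Finset
open scoped Real BigOperators ArithmeticFunction.vonMangoldt

namespace Summit.RiemannHypothesis.RiemannHypothesis.Theorems.WeilFormatC

open Literature.NumberTheory.LFunctions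

variable {a : ℝ}

/-! ### Range expansions (`Λ` values from `WeilFarFloorLowerBounds`) and window facts `e^{2a} ≤ N` -/

/-- Range-`7` expansion (terms `2, 3, 4, 5`; covers range `6` as well). -/
theorem sum_range_seven_vonMangoldt (I : ℝ → ℝ) :
    ∑ n ∈ Finset.range 7, 2 * ((Λ n : ℝ) / Real.sqrt n) * I (Real.log n) =
      2 * (Real.log 2 / Real.sqrt 2) * I (Real.log 2) + 2 * (Real.log 3 / Real.sqrt 3) * I (Real.log 3) +
      2 * (Real.log 2 / 2) * I (2 * Real.log 2) + 2 * (Real.log 5 / Real.sqrt 5) * I (Real.log 5) := by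
  have hs4 : Real.sqrt ((4 : ℕ) : ℝ) = 2 := by
    rw [show ((4 : ℕ) : ℝ) = 2 ^ 2 by norm_num, Real.sqrt_sq (by norm_num)]
  have h4 : Real.log ((4 : ℕ) : ℝ) = 2 * Real.log 2 := by
    rw [show ((4 : ℕ) : ℝ) = 2 ^ 2 by norm_num, Real.log_pow]; norm_num
  simp only [Finset.sum_range_succ, Finset.sum_range_zero, FloorLower.vm_0, FloorLower.vm_1, FloorLower.vm_2,
    FloorLower.vm_3, FloorLower.vm_4, FloorLower.vm_5, FloorLower.vm_6, zero_div, zero_mul, mul_zero, zero_add, add_zero,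
    hs4, h4]
  push_cast
  ring

/-- Range-`6` expansion (terms `2, 3, 4, 5`). -/
theorem sum_range_six_vonMangoldt (I : ℝ → ℝ) :
    ∑ n ∈ Finset.range 6, 2 * ((Λ n : ℝ) / Real.sqrt n) * I (Real.log n) =
      2 * (Real.log 2 / Real.sqrt 2) * I (Real.log 2) + 2 * (Real.log 3 / Real.sqrt 3) * I (Real.log 3) +
      2 * (Real.log 2 / 2) * I (2 * Real.log 2) + 2 * (Real.log 5 / Real.sqrt 5) * I (Real.log 5) := by
  have hs4 : Real.sqrt ((4 : ℕ) : ℝ) = 2 := by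
    rw [show ((4 : ℕ) : ℝ) = 2 ^ 2 by norm_num, Real.sqrt_sq (by norm_num)]
  have h4 : Real.log ((4 : ℕ) : ℝ) = 2 * Real.log 2 := by
    rw [show ((4 : ℕ) : ℝ) = 2 ^ 2 by norm_num, Real.log_pow]; norm_num
  simp only [Finset.sum_range_succ, Finset.sum_range_zero, FloorLower.vm_0, FloorLower.vm_1, FloorLower.vm_2,
    FloorLower.vm_3, FloorLower.vm_4, FloorLower.vm_5, zero_div, zero_mul, mul_zero, zero_add, add_zero, hs4, h4]
  push_cast
  ring

/-- Range-`8` expansion (terms `2, 3, 4, 5, 7`). -/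
theorem sum_range_eight_vonMangoldt (I : ℝ → ℝ) :
    ∑ n ∈ Finset.range 8, 2 * ((Λ n : ℝ) / Real.sqrt n) * I (Real.log n) =
      2 * (Real.log 2 / Real.sqrt 2) * I (Real.log 2) + 2 * (Real.log 3 / Real.sqrt 3) * I (Real.log 3) +
      2 * (Real.log 2 / 2) * I (2 * Real.log 2) + 2 * (Real.log 5 / Real.sqrt 5) * I (Real.log 5) +
      2 * (Real.log 7 / Real.sqrt 7) * I (Real.log 7) := by
  rw [Finset.sum_range_succ, sum_range_seven_vonMangoldt I, FloorLower.vm_7]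
  push_cast
  ring

/-- Range-`9` expansion (terms `2, 3, 4, 5, 7, 8`). -/
theorem sum_range_nine_vonMangoldt (I : ℝ → ℝ) :
    ∑ n ∈ Finset.range 9, 2 * ((Λ n : ℝ) / Real.sqrt n) * I (Real.log n) =
      2 * (Real.log 2 / Real.sqrt 2) * I (Real.log 2) + 2 * (Real.log 3 / Real.sqrt 3) * I (Real.log 3) +
      2 * (Real.log 2 / 2) * I (2 * Real.log 2) + 2 * (Real.log 5 / Real.sqrt 5) * I (Real.log 5) +
      2 * (Real.log 7 / Real.sqrt 7) * I (Real.log 7) + 2 * (Real.log 2 / Real.sqrt 8) * I (3 * Real.log 2) := by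
  have h8 : Real.log ((8 : ℕ) : ℝ) = 3 * Real.log 2 := by
    rw [show ((8 : ℕ) : ℝ) = 2 ^ 3 by norm_num, Real.log_pow]; norm_num
  rw [Finset.sum_range_succ, sum_range_eight_vonMangoldt I, FloorLower.vm_8, h8]
  push_cast
  ring

/-- `6369/4000 ≤ log 6` hence `e^{2·83/100} ≤ 6` (fixed-point logarithm). -/
theorem exp_two_mul_083_le_six : Real.exp (2 * (83 / 100 : ℝ)) ≤ ((6 : ℕ) : ℝ) := by
  have h6 := FloorLower.log_bracket (m := 6) (e := 2) (LOn := 1791759468) (LOd := 1000000000) (HIn := 1791759471)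
    (HId := 1000000000) (by norm_num) (by norm_num) (by norm_num) (by norm_num) (by decide +kernel) (by decide +kernel)
  push_cast at h6
  exact FloorLower.exp_two_mul_le_of_lt_log (by norm_num) h6.1 (by norm_num)

/-- `e^{2·9/10} ≤ 7`. -/
theorem exp_two_mul_09_le_seven : Real.exp (2 * (9 / 10 : ℝ)) ≤ ((7 : ℕ) : ℝ) :=
  FloorLower.exp_two_mul_le_of_lt_log (by norm_num) (by exact_mod_cast FloorLower.br_7.1) (by norm_num)

/-- `e^{2·9729/10000} ≤ 7` (`1.9458 < 1.945910148 ≤ log 7`). -/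
theorem exp_two_mul_09729_le_seven : Real.exp (2 * (9729 / 10000 : ℝ)) ≤ ((7 : ℕ) : ℝ) :=
  FloorLower.exp_two_mul_le_of_lt_log (by norm_num) (by exact_mod_cast FloorLower.br_7.1) (by norm_num)

/-- `e² ≤ 8`. -/
theorem exp_two_mul_one_le_eight : Real.exp (2 * (1 : ℝ)) ≤ ((8 : ℕ) : ℝ) :=
  FloorLower.exp_two_mul_le_of_lt_log (by norm_num) (by exact_mod_cast FloorLower.br_8.1) (by norm_num)

/-- `e^{2·10397/10000} ≤ 8` (`2.0794 < 2.079441540 ≤ log 8`). -/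
theorem exp_two_mul_10397_le_eight : Real.exp (2 * (10397 / 10000 : ℝ)) ≤ ((8 : ℕ) : ℝ) :=
  FloorLower.exp_two_mul_le_of_lt_log (by norm_num) (by exact_mod_cast FloorLower.br_8.1) (by norm_num)

/-- `e^{2·1098/1000} ≤ 9`. -/
theorem exp_two_mul_1098_le_nine : Real.exp (2 * (1098 / 1000 : ℝ)) ≤ ((9 : ℕ) : ℝ) :=
  FloorLower.exp_two_mul_le_of_lt_log (by norm_num) (by exact_mod_cast FloorLower.br_9.1) (by norm_num)

/-- `e^{2·1198/1000} ≤ 11`. -/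
theorem exp_two_mul_1198_le_eleven : Real.exp (2 * (1198 / 1000 : ℝ)) ≤ ((11 : ℕ) : ℝ) :=
  FloorLower.exp_two_mul_le_of_lt_log (by norm_num) (by exact_mod_cast FloorLower.br_11.1) (by norm_num)

/-- `e^{2·1289/1000} ≤ 14` (`2.578 < 2.639 ≤ log 14`, fixed-point logarithm). -/
theorem exp_two_mul_1289_le_fourteen : Real.exp (2 * (1289 / 1000 : ℝ)) ≤ ((14 : ℕ) : ℝ) := by
  have h14 := FloorLower.log_bracket (m := 14) (e := 3) (LOn := 164941083) (LOd := 62500000) (HIn := 2639057331)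
    (HId := 1000000000) (by norm_num) (by norm_num) (by norm_num) (by norm_num) (by decide +kernel) (by decide +kernel)
  push_cast at h14
  exact FloorLower.exp_two_mul_le_of_lt_log (by norm_num) h14.1 (by norm_num)

/-! ### The brackets -/

/-- **`1838/1000 ≤ λ_max(1)`** (two-step test function of `WeilFarFloorLowerBounds`). -/
theorem farCoercivityFloor_one_ge : (1838 / 1000 : ℝ) ≤ farCoercivityFloor 1 :=
  FloorLower.le_of_shiftBound_range8_one (shiftBound_range_floor exp_two_mul_one_le_eight)

/-- **`2649/1000 ≤ λ_max(1198/1000)`**. -/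
theorem farCoercivityFloor_1198_ge : (2649 / 1000 : ℝ) ≤ farCoercivityFloor (1198 / 1000) :=
  FloorLower.le_of_shiftBound_range11_1198 (shiftBound_range_floor exp_two_mul_1198_le_eleven)

/-- **`3080/1000 ≤ λ_max(1289/1000)`** (the A1 cusp window). -/
theorem farCoercivityFloor_1289_ge : (3080 / 1000 : ℝ) ≤ farCoercivityFloor (1289 / 1000) :=
  FloorLower.le_of_shiftBound_range14_1289 (shiftBound_range_floor exp_two_mul_1289_le_fourteen)

/-- **`λ_max(83/100) ≤ 1574/1000`** from the landed route-K3 row `jointShiftBound_le_083_cells`. -/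
theorem farCoercivityFloor_083_le : farCoercivityFloor (83 / 100 : ℝ) ≤ 1574 / 1000 := by
  refine farCoercivityFloor_le_of_rangeBound (by norm_num) exp_two_mul_083_le_six fun f C hf hC hsupp ↦ ?_
  have hle : -(83 / 100 : ℝ) ≤ 83 / 100 := by norm_num
  have h := jointShiftBound_le_083_cells (by norm_num) le_rfl hf hC hsupp
  rw [← shiftCorr_eq_intervalIntegral hsupp hle, ← shiftCorr_eq_intervalIntegral hsupp hle, ← shiftCorr_eq_intervalIntegral hsupp hle, ← shiftCorr_eq_intervalIntegral hsupp hle, ← integral_sq_eq_intervalIntegral hsupp hle] at h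
  rw [sum_range_six_vonMangoldt (fun u ↦ ∫ x, f (x - u) * f x)]
  linarith

/-- **`λ_max(9/10) ≤ 1730/1000`** from the landed route-K3 row `jointShiftBound_le_09_cells`. -/
theorem farCoercivityFloor_09_le : farCoercivityFloor (9 / 10 : ℝ) ≤ 1730 / 1000 := by
  refine farCoercivityFloor_le_of_rangeBound (by norm_num) exp_two_mul_09_le_seven fun f C hf hC hsupp ↦ ?_
  have hle : -(9 / 10 : ℝ) ≤ 9 / 10 := by norm_num
  have h := jointShiftBound_le_09_cells (by norm_num) le_rfl hf hC hsupp
  rw [← shiftCorr_eq_intervalIntegral hsupp hle, ← shiftCorr_eq_intervalIntegral hsupp hle, ← shiftCorr_eq_intervalIntegral hsupp hle, ← shiftCorr_eq_intervalIntegral hsupp hle, ← integral_sq_eq_intervalIntegral hsupp hle] at h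
  rw [sum_range_seven_vonMangoldt (fun u ↦ ∫ x, f (x - u) * f x)]
  linarith

/-- **`λ_max(9729/10000) ≤ 1825/1000`** from the landed route-K3 row `jointShiftBound_le_09729_cells`. -/
theorem farCoercivityFloor_09729_le : farCoercivityFloor (9729 / 10000 : ℝ) ≤ 1825 / 1000 := by
  refine farCoercivityFloor_le_of_rangeBound (by norm_num) exp_two_mul_09729_le_seven fun f C hf hC hsupp ↦ ?_
  have hle : -(9729 / 10000 : ℝ) ≤ 9729 / 10000 := by norm_num
  have h := jointShiftBound_le_09729_cells (by norm_num) le_rfl hf hC hsupp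
  rw [← shiftCorr_eq_intervalIntegral hsupp hle, ← shiftCorr_eq_intervalIntegral hsupp hle, ← shiftCorr_eq_intervalIntegral hsupp hle, ← shiftCorr_eq_intervalIntegral hsupp hle, ← integral_sq_eq_intervalIntegral hsupp hle] at h
  rw [sum_range_seven_vonMangoldt (fun u ↦ ∫ x, f (x - u) * f x)]
  linarith

/-- **`λ_max(1) ≤ 2027/1000`** from the landed route-K3 row `jointShiftBound_one_cells_v2`. -/
theorem farCoercivityFloor_one_le : farCoercivityFloor (1 : ℝ) ≤ 2027 / 1000 := by
  refine farCoercivityFloor_le_of_rangeBound (by norm_num) exp_two_mul_one_le_eight fun f C hf hC hsupp ↦ ?_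
  have hle : -(1 : ℝ) ≤ 1 := by norm_num
  have h := jointShiftBound_one_cells_v2 (by norm_num) le_rfl hf hC hsupp
  rw [← shiftCorr_eq_intervalIntegral hsupp hle, ← shiftCorr_eq_intervalIntegral hsupp hle, ← shiftCorr_eq_intervalIntegral hsupp hle, ← shiftCorr_eq_intervalIntegral hsupp hle, ← shiftCorr_eq_intervalIntegral hsupp hle, ← integral_sq_eq_intervalIntegral hsupp hle] at h
  rw [sum_range_eight_vonMangoldt (fun u ↦ ∫ x, f (x - u) * f x)]
  linarith

/-- **`λ_max(10397/10000) ≤ 2148/1000`** from the landed route-K3 row `jointShiftBound_le_10397_cells_v2`. -/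
theorem farCoercivityFloor_10397_le : farCoercivityFloor (10397 / 10000 : ℝ) ≤ 2148 / 1000 := by
  refine farCoercivityFloor_le_of_rangeBound (by norm_num) exp_two_mul_10397_le_eight fun f C hf hC hsupp ↦ ?_
  have hle : -(10397 / 10000 : ℝ) ≤ 10397 / 10000 := by norm_num
  have h := jointShiftBound_le_10397_cells_v2 (by norm_num) le_rfl hf hC hsupp
  rw [← shiftCorr_eq_intervalIntegral hsupp hle, ← shiftCorr_eq_intervalIntegral hsupp hle, ← shiftCorr_eq_intervalIntegral hsupp hle, ← shiftCorr_eq_intervalIntegral hsupp hle, ← shiftCorr_eq_intervalIntegral hsupp hle, ← integral_sq_eq_intervalIntegral hsupp hle] at h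
  rw [sum_range_eight_vonMangoldt (fun u ↦ ∫ x, f (x - u) * f x)]
  linarith

/-- **`λ_max(1098/1000) ≤ 2358/1000`** from the landed route-K3 row `jointShiftBound_le_1098_cells`. -/
theorem farCoercivityFloor_1098_le : farCoercivityFloor (1098 / 1000 : ℝ) ≤ 2358 / 1000 := by
  refine farCoercivityFloor_le_of_rangeBound (by norm_num) exp_two_mul_1098_le_nine fun f C hf hC hsupp ↦ ?_
  have hle : -(1098 / 1000 : ℝ) ≤ 1098 / 1000 := by norm_num
  have h := jointShiftBound_le_1098_cells (by norm_num) le_rfl hf hC hsupp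
  rw [← shiftCorr_eq_intervalIntegral hsupp hle, ← shiftCorr_eq_intervalIntegral hsupp hle, ← shiftCorr_eq_intervalIntegral hsupp hle, ← shiftCorr_eq_intervalIntegral hsupp hle, ← shiftCorr_eq_intervalIntegral hsupp hle, ← shiftCorr_eq_intervalIntegral hsupp hle, ← integral_sq_eq_intervalIntegral hsupp hle] at h
  rw [sum_range_nine_vonMangoldt (fun u ↦ ∫ x, f (x - u) * f x)]
  linarith

/-- **The kernel bracket at `a = 1`: `λ_max(1) ∈ [1838/1000, 2027/1000]`** (Galerkin float 1.946; the law's asymptotic value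
`L(1) − 2γ_E = 1.750` lies BELOW the proved lower bound — the in-sample discrepancy `+0.196` of C-XIII at `a = 1` is a theorem-level fact). -/
theorem farCoercivityFloor_one_mem_Icc : farCoercivityFloor 1 ∈ Icc (1838 / 1000 : ℝ) (2027 / 1000) :=
  ⟨farCoercivityFloor_one_ge, farCoercivityFloor_one_le⟩

/-- Hence every proved lower bracket propagates upward: `3080/1000 ≤ λ_max(a)` for all `a ≥ 1289/1000`. -/
theorem farCoercivityFloor_ge_3080_of_le {a : ℝ} (ha : (1289 / 1000 : ℝ) ≤ a) : (3080 / 1000 : ℝ) ≤ farCoercivityFloor a :=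
  farCoercivityFloor_1289_ge.trans (farCoercivityFloor_mono (by norm_num) ha)

end Summit.RiemannHypothesis.RiemannHypothesis.Theorems.WeilFormatC
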